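import Literature.NumberTheory.Automorphic.HeckeFamilyTraceMultiplicity
import Literature.NumberTheory.Automorphic.BrandtMultiplicativityHolds
import Literature.NumberTheory.Automorphic.BrandtModuleCommProofs
import Literature.NumberTheory.Automorphic.BrandtModuleWeightSymmProofs
import Literature.NumberTheory.Automorphic.BrandtModuleRamifiedFibre
import Literature.NumberTheory.Automorphic.BrandtModuleDictionary
import Literature.NumberTheory.Automorphic.BrandtMatrixOne
import Literature.NumberTheory.Automorphic.EichlerSubidealCount
import Literature.NumberTheory.Automorphic.DefiniteOrderUnitsFinite
import Literature.NumberTheory.EllipticCurves.NewformsSpanProofs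
import HarnessLib

/-!
# The Brandt matrices of a Brandt setup form a semisimple commuting Hecke family
# (Pizer 1980, Prop. 2.22: "the `B(n)` with `(n, N) = 1` generate a commutative semisimple ring")

Topic `NumberTheory/Automorphic`; theorems and one definition with body (no named fact). For a
Brandt setup `S` of type `(N⁺, N⁻)` (`BrandtXi.lean`: definite quaternion algebra of discriminant
`N⁻`, Eichler order `O` of level `N⁺`) the complexified Brandt matrices
`T(n) = Brandt.matrix S.O n` acting on `ℂ^{Cls O}` by `Matrix.mulVec` (`Brandt.XiSetup.heckeFamily`)
satisfy the hypotheses of the abstract trace/multiplicity engine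
`HeckeFamilyTraceMultiplicity.lean`:

* `Brandt.XiSetup.isResiduallySplit` — the Eichler order of a setup is **residually split at every
  prime `p ∤ N⁺N⁻`**: by the tree's dichotomy (`IsEichlerOrder.residuallySplit_or_ramified`,
  Vignéras II §§1–2) it is residually split or residually ramified, and in the ramified case an
  invertible ideal has at most one invertible sub-ideal of index `p²`
  (`IsRamifiedData.subsingleton_subideal`), contradicting Eichler's count `p + 1`
  (`IsEichlerOrder.natCard_subideals_eq_prime_add_one`, Eichler 1973 II §6 (16)).
* `Brandt.XiSetup.matrix_prime_pow` — hence the **Hecke recursion at good primes**,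
  `T(p^{a+2}) = T(p) T(p^{a+1}) - p T(p^a)` for `p ∤ N⁺N⁻` (Eichler 1973 II §6 Thm. 2 (19);
  Vignéras III §5 ex. 5.8 (c); Pizer 1980 Prop. 2.22), transported from the tree's
  `BrandtData.ofOrder_T_pow_succ_mul_T` (fibre count `p + 1`, `IsResiduallySplit.card_fibre`)
  through the dictionary `BrandtData.ofOrder_T_eq_transpose_reindex`.
* `Brandt.XiSetup.isHeckeFamily` — with `T(1) = 1` (`Brandt.matrix_one`) and
  `T(mn) = T(m) T(n)` for coprime `m, n` (`XiSetup.matrix_mul_of_coprime`): the complexified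
  Brandt matrices are a Hecke family away from `N⁺N⁻` with constants `c(p) = p`.
* `Brandt.XiSetup.isSemisimpleFamily` — the `T(p)`, `p ∤ N⁺N⁻`, commute
  (`XiSetup.matrix_comm_of_coprime`) and are self-adjoint for the definite Hermitian form
  `⟨x, y⟩ = Σ_i w_i x̄_i y_i` (weight symmetry `w_i T_ij = w_j T_ji`,
  `XiSetup.weight_mul_matrix_symm`; `w_i ≥ 1`, `XiSetup.one_le_weight`), hence diagonalisable
  (`maxGenEigenspace_eq_eigenspace_of_selfAdjoint`): a semisimple commuting family.
* `Brandt.XiSetup.trace_heckeFamily` — `tr T(n) = Σ_i T(n)_ii`;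
  `Brandt.XiSetup.heckeFamily_eisensteinVector` — the vector `u_i = 1/w_i` is a common
  eigenvector with the Eisenstein eigenvalues `p + 1` (column sums `p + 1`,
  `XiSetup.sum_matrix_prime_eq`, and weight symmetry);
  `Brandt.XiSetup.eigenChar_heckeFamily_eq_eigenSpace` — the simultaneous eigenspace of the
  character `p ↦ λ(p)` is the tree's `Brandt.eigenSpace ℂ (N⁺N⁻) (Brandt.matrix S.O) λ`.

## References

* [Pizer1980] A. Pizer, J. Algebra 64 (1980), Prop. 2.22, Thm. 2.28.
* [Eichler1973] M. Eichler, LNM 320 (1973), Ch. II §6 (16) and Thm. 2 (17)–(19).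
* [VignerasLNM800] M.-F. Vignéras, LNM 800 (1980), Ch. II §§1–2, Ch. III §5 ex. 5.8.
-/

noncomputable section

open scoped BigOperators Pointwise ComplexConjugate Matrix
open Module Module.End

universe u

namespace Literature.NumberTheory.Automorphic

namespace Brandt

variable {Nplus Nminus : ℕ}

/-! ### Residual splitting at the good primes -/

/-- **The Eichler order of a Brandt setup is residually split at every prime `p ∤ N⁺N⁻`.**
Dichotomy `IsEichlerOrder.residuallySplit_or_ramified`; the ramified branch would leave at most one
invertible sub-ideal of index `p²` in `O` (`IsRamifiedData.subsingleton_subideal`), against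
Eichler's count `p + 1 ≥ 3` (`IsEichlerOrder.natCard_subideals_eq_prime_add_one`).
[cite: VignerasLNM800, Ch. II §2 Thm. 2.3] -/
theorem XiSetup.isResiduallySplit (S : XiSetup Nplus Nminus) {p : ℕ} (hp : p.Prime)
    (hpN : ¬ p ∣ Nplus * Nminus) :
    (isEichlerOrder_iff_brandt.mpr S.isEichlerOrder).isZOrder.IsResiduallySplit p := by
  haveI : Fact p.Prime := ⟨hp⟩
  have hE : _root_.Literature.NumberTheory.Automorphic.IsEichlerOrder S.O Nplus :=
    isEichlerOrder_iff_brandt.mpr S.isEichlerOrder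
  have hpNplus : ¬ p ∣ Nplus := fun h => hpN (dvd_mul_of_dvd_left h Nminus)
  have hpNminus : ¬ p ∣ Nminus := fun h => hpN (dvd_mul_of_dvd_right h Nplus)
  rcases hE.residuallySplit_or_ramified hp ((Nat.Prime.coprime_iff_not_dvd hp).mpr hpNplus) with
    hs | hr
  · exact hs
  · exfalso
    have hdiv : ∀ x : S.D, x ≠ 0 → IsUnit x := fun x hx =>
      isUnit_of_isTotallyDefinite S.D S.isTotallyDefinite hx
    have hO : IsZOrder S.O := hE.isZOrder
    have hI : IsInvertibleRightIdeal S.O S.O := hO.isInvertibleRightIdeal_self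
    have hcount := hE.natCard_subideals_eq_prime_add_one hdiv hpNplus
      (S.nonempty_algEquiv_padic hpNminus) hI
    obtain ⟨P, hP⟩ := hr.exists_isRamifiedData
    obtain ⟨π, -, hπ, hvπ⟩ := hP.exists_uniformizer hO hp hdiv
    obtain ⟨α, -, hα⟩ := hI.exists_localAt_eq_units_smul hdiv hO p
    have hsub : Subsingleton (Subideal S.O S.O (p ^ 1)) :=
      hP.subsingleton_subideal hO hp hπ hvπ hdiv hα 1
    rw [pow_one] at hsub
    change Nat.card (Subideal S.O S.O p) = p + 1 at hcount
    haveI : Finite (Subideal S.O S.O p) := Nat.finite_of_card_ne_zero (by rw [hcount]; omega)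
    have hle : Nat.card (Subideal S.O S.O p) ≤ 1 := Finite.card_le_one_iff_subsingleton.mpr hsub
    have := hp.two_le
    omega

/-! ### The Hecke recursion at good primes -/

/-- **`T(p^{a+1}) T(p) = T(p^{a+2}) + p T(p^a)` for the Brandt data `BrandtData.ofOrder S.O`**
of a setup, `p ∤ N⁺N⁻` (fibre count `p + 1` at a residually split prime). [cite: VignerasLNM800, Ch. III §5 exercice 5.8 (c)] -/
theorem XiSetup.ofOrder_T_pow_succ_mul_T (S : XiSetup Nplus Nminus) {p : ℕ} (hp : p.Prime)
    (hpN : ¬ p ∣ Nplus * Nminus) (a : ℕ) :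
    (BrandtData.ofOrder S.O (isEichlerOrder_iff_brandt.mpr S.isEichlerOrder).isZOrder).T (p ^ (a + 1)) *
        (BrandtData.ofOrder S.O (isEichlerOrder_iff_brandt.mpr S.isEichlerOrder).isZOrder).T p =
      (BrandtData.ofOrder S.O (isEichlerOrder_iff_brandt.mpr S.isEichlerOrder).isZOrder).T (p ^ (a + 1) * p) +
        (p : ℤ) • (BrandtData.ofOrder S.O (isEichlerOrder_iff_brandt.mpr S.isEichlerOrder).isZOrder).T (p ^ a) := by
  have hdiv : ∀ x : S.D, x ≠ 0 → IsUnit x := fun x hx =>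
    isUnit_of_isTotallyDefinite S.D S.isTotallyDefinite hx
  have hs := S.isResiduallySplit hp hpN
  exact BrandtData.ofOrder_T_pow_succ_mul_T _ hp p a
    (fun i K hK => (hs.card_fibre hdiv hp (RightIdealClass.isInvertibleRightIdeal_rep i) K).1 hK)
    (fun i K hK => (hs.card_fibre hdiv hp (RightIdealClass.isInvertibleRightIdeal_rep i) K).2 hK)

/-- **The Hecke recursion for the Brandt matrices of a setup at a good prime**:
`T(p^{a+2}) = T(p) T(p^{a+1}) - p T(p^a)` for `p ∤ N⁺N⁻` (Eichler 1973 II §6 Thm. 2 (19),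
Pizer 1980 Prop. 2.22; `Brandt.matrix` is the transpose of Eichler's `B(n)` reindexed,
`BrandtData.ofOrder_T_eq_transpose_reindex`, so the order of the factors is reversed).
[cite: Eichler1973, Ch. II §6 Thm. 2 (19)] -/
theorem XiSetup.matrix_prime_pow (S : XiSetup Nplus Nminus) [Fintype (ClassSet S.O)] {p : ℕ}
    (hp : p.Prime) (hpN : ¬ p ∣ Nplus * Nminus) (a : ℕ) :
    matrix S.O (p ^ (a + 2)) = matrix S.O p * matrix S.O (p ^ (a + 1)) - (p : ℤ) • matrix S.O (p ^ a) := by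
  have hO : IsZOrder S.O := (isEichlerOrder_iff_brandt.mpr S.isEichlerOrder).isZOrder
  have hri : rightIdeals S.O = invertibleRightIdeals S.O :=
    rightIdeals_eq_invertibleRightIdeals_of_isTotallyDefinite S.isTotallyDefinite hO
  have key := S.ofOrder_T_pow_succ_mul_T hp hpN a
  set e := ClassSet.equivRightIdealClass hri with he
  have hT : ∀ (n : ℕ) (i j : ClassSet S.O), (BrandtData.ofOrder S.O hO).T n (e i) (e j) = matrix S.O n j i :=
    fun n i j => BrandtData.ofOrder_T_equivRightIdealClass hO hri n i j
  rw [eq_sub_iff_add_eq, show p ^ (a + 2) = p ^ (a + 1) * p by ring]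
  letI : Fintype (RightIdealClass S.O) := (BrandtData.ofOrder S.O hO).instFintype
  ext i j
  have hent := congrFun (congrFun key (e j)) (e i)
  simp only [Matrix.mul_apply, Matrix.add_apply, Matrix.smul_apply, smul_eq_mul, hT] at hent
  rw [Matrix.add_apply, Matrix.smul_apply, smul_eq_mul, ← hent, Matrix.mul_apply]
  symm
  refine Fintype.sum_equiv e _ _ fun k => ?_
  rw [hT, hT, mul_comm]

/-! ### The complexified Brandt matrices as a Hecke family on `ℂ^{Cls O}` -/

/-- The complexified Brandt matrix `T(n)` of a setup. [folklore] -/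
def XiSetup.matrixC (S : XiSetup Nplus Nminus) (n : ℕ) : Matrix (ClassSet S.O) (ClassSet S.O) ℂ :=
  (matrix S.O n).map (Int.castRingHom ℂ)

/-- Entries of `matrixC`. [folklore] -/
@[simp] theorem XiSetup.matrixC_apply (S : XiSetup Nplus Nminus) (n : ℕ) (i j : ClassSet S.O) :
    S.matrixC n i j = (matrix S.O n i j : ℂ) := by
  simp [XiSetup.matrixC, Matrix.map_apply]

/-- `matrixC` is multiplicative. [folklore] -/
theorem XiSetup.matrixC_mul (S : XiSetup Nplus Nminus) [Fintype (ClassSet S.O)] (m n : ℕ) :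
    (matrix S.O m * matrix S.O n).map (Int.castRingHom ℂ) = S.matrixC m * S.matrixC n :=
  Matrix.map_mul

/-- `matrixC` of a difference. [folklore] -/
theorem XiSetup.map_sub_eq (S : XiSetup Nplus Nminus) (M N : Matrix (ClassSet S.O) (ClassSet S.O) ℤ) :
    (M - N).map (Int.castRingHom ℂ) = M.map (Int.castRingHom ℂ) - N.map (Int.castRingHom ℂ) :=
  Matrix.map_sub _ (map_sub _) _ _

/-- `matrixC` of an integer multiple. [folklore] -/
theorem XiSetup.map_natCast_smul_eq (S : XiSetup Nplus Nminus) (c : ℕ)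
    (M : Matrix (ClassSet S.O) (ClassSet S.O) ℤ) :
    ((c : ℤ) • M).map (Int.castRingHom ℂ) = (c : ℂ) • M.map (Int.castRingHom ℂ) := by
  ext i j
  rw [Matrix.map_apply, Matrix.smul_apply, Matrix.smul_apply, Matrix.map_apply, smul_eq_mul,
    smul_eq_mul, map_mul, eq_intCast, eq_intCast, Int.cast_natCast]

/-- **The Hecke family of a Brandt setup**: `T(n)` acting on `ℂ^{Cls O}` by `Matrix.mulVec`
(Gross's `t_n` in coordinates; the action used by `Brandt.eigenSpace` / `Brandt.eigenLattice`).
[cite: Pizer1980, Prop. 2.22] -/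
def XiSetup.heckeFamily (S : XiSetup Nplus Nminus) [Fintype (ClassSet S.O)] (n : ℕ) :
    Module.End ℂ (ClassSet S.O → ℂ) :=
  Matrix.mulVecLin (S.matrixC n)

/-- `heckeFamily` is `mulVec` by the complexified Brandt matrix. [folklore] -/
@[simp] theorem XiSetup.heckeFamily_apply (S : XiSetup Nplus Nminus) [Fintype (ClassSet S.O)] (n : ℕ)
    (v : ClassSet S.O → ℂ) : S.heckeFamily n v = (matrix S.O n).map (Int.castRingHom ℂ) *ᵥ v :=
  rfl

/-- `heckeFamily n = Matrix.toLin' (T(n))` (for the trace computation). [folklore] -/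
theorem XiSetup.heckeFamily_eq_toLin' (S : XiSetup Nplus Nminus) [Fintype (ClassSet S.O)]
    [DecidableEq (ClassSet S.O)] (n : ℕ) : S.heckeFamily n = Matrix.toLin' (S.matrixC n) :=
  rfl

/-- **The complexified Brandt matrices of a setup are a Hecke family away from `N⁺N⁻`** with
prime-power constants `c(p) = p`: `T(1) = 1`, `T(mn) = T(m) T(n)` for coprime `m, n`, and
`T(p^{a+2}) = T(p) T(p^{a+1}) - p T(p^a)` for `p ∤ N⁺N⁻`. [cite: Pizer1980, Prop. 2.22] -/
theorem XiSetup.isHeckeFamily (S : XiSetup Nplus Nminus) [Fintype (ClassSet S.O)] :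
    IsHeckeFamily (Nplus * Nminus) (fun p => (p : ℂ)) S.heckeFamily where
  map_one := by
    classical
    change Matrix.mulVecLin (S.matrixC 1) = 1
    rw [XiSetup.matrixC, matrix_one, Matrix.map_one _ (map_zero _) (map_one _), Matrix.mulVecLin_one]
    rfl
  map_mul_of_coprime {m n} hmn _ := by
    change Matrix.mulVecLin (S.matrixC (m * n)) = Matrix.mulVecLin (S.matrixC m) * Matrix.mulVecLin (S.matrixC n)
    rw [XiSetup.matrixC, S.matrix_mul_of_coprime hmn, S.matrixC_mul, Matrix.mulVecLin_mul]
    rfl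
  map_prime_pow {q} hq hqN a := by
    change Matrix.mulVecLin (S.matrixC (q ^ (a + 2))) =
      Matrix.mulVecLin (S.matrixC q) * Matrix.mulVecLin (S.matrixC (q ^ (a + 1))) -
        (q : ℂ) • Matrix.mulVecLin (S.matrixC (q ^ a))
    rw [XiSetup.matrixC, S.matrix_prime_pow hq hqN a, S.map_sub_eq, S.matrixC_mul, S.map_natCast_smul_eq]
    apply LinearMap.ext
    intro v
    simp only [Matrix.mulVecLin_apply, LinearMap.sub_apply, LinearMap.smul_apply, Module.End.mul_apply,
      Matrix.sub_mulVec, Matrix.smul_mulVec, Matrix.mulVec_mulVec]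
    rfl

/-! ### Commutation and self-adjointness: a semisimple commuting family -/

/-- The `T(p)`, `T(q)` of a setup at primes commute. [cite: Pizer1980, Prop. 2.22] -/
theorem XiSetup.heckeFamily_comm (S : XiSetup Nplus Nminus) [Fintype (ClassSet S.O)] {p q : ℕ}
    (hp : p.Prime) (hq : q.Prime) : Commute (S.heckeFamily p) (S.heckeFamily q) := by
  by_cases hpq : p = q
  · subst hpq; exact Commute.refl _
  · have hcop : p.Coprime q := (Nat.coprime_primes hp hq).mpr hpq
    change Matrix.mulVecLin (S.matrixC p) * Matrix.mulVecLin (S.matrixC q) =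
      Matrix.mulVecLin (S.matrixC q) * Matrix.mulVecLin (S.matrixC p)
    change Matrix.mulVecLin (S.matrixC p) ∘ₗ Matrix.mulVecLin (S.matrixC q) =
      Matrix.mulVecLin (S.matrixC q) ∘ₗ Matrix.mulVecLin (S.matrixC p)
    rw [← Matrix.mulVecLin_mul, ← Matrix.mulVecLin_mul, ← S.matrixC_mul, ← S.matrixC_mul,
      S.matrix_comm_of_coprime hcop]

/-- The weighted Hermitian form `⟨x, y⟩ = Σ_i w_i x̄_i y_i` on `ℂ^{Cls O}` (Gross's height pairing,
sesquilinear version). [folklore] -/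
def XiSetup.weightForm (S : XiSetup Nplus Nminus) [Fintype (ClassSet S.O)] (x y : ClassSet S.O → ℂ) : ℂ :=
  ∑ i, (weight S.O i : ℂ) * (conj (x i) * y i)

/-- **`T(n)` is self-adjoint for the weighted form** (`w_i T_ij = w_j T_ji`,
`XiSetup.weight_mul_matrix_symm`). [cite: Eichler1973, Ch. II §6 Thm. 2 eq. (17)] -/
theorem XiSetup.weightForm_heckeFamily (S : XiSetup Nplus Nminus) [Fintype (ClassSet S.O)] (n : ℕ)
    (x y : ClassSet S.O → ℂ) :
    S.weightForm (S.heckeFamily n x) y = S.weightForm x (S.heckeFamily n y) := by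
  have hL : ∀ i, (S.heckeFamily n x) i = ∑ j, (matrix S.O n i j : ℂ) * x j := fun i => by
    rw [XiSetup.heckeFamily_apply, Matrix.mulVec, dotProduct]
    simp [Matrix.map_apply]
  have hR : ∀ j, (S.heckeFamily n y) j = ∑ i, (matrix S.O n j i : ℂ) * y i := fun j => by
    rw [XiSetup.heckeFamily_apply, Matrix.mulVec, dotProduct]
    simp [Matrix.map_apply]
  simp only [XiSetup.weightForm, hL, hR, map_sum, map_mul, map_intCast, Finset.mul_sum, Finset.sum_mul]
  rw [Finset.sum_comm]
  refine Finset.sum_congr rfl fun i _ => Finset.sum_congr rfl fun j _ => ?_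
  have h := S.weight_mul_matrix_symm n j i
  have h' : ((weight S.O j : ℤ) : ℂ) * ((matrix S.O n j i : ℤ) : ℂ) =
      ((weight S.O i : ℤ) : ℂ) * ((matrix S.O n i j : ℤ) : ℂ) := by exact_mod_cast h
  push_cast at h'
  calc (weight S.O j : ℂ) * ((matrix S.O n j i : ℂ) * conj (x i) * y j)
      = ((weight S.O j : ℂ) * (matrix S.O n j i : ℂ)) * (conj (x i) * y j) := by ring
    _ = ((weight S.O i : ℂ) * (matrix S.O n i j : ℂ)) * (conj (x i) * y j) := by rw [h']
    _ = (weight S.O i : ℂ) * (conj (x i) * ((matrix S.O n i j : ℂ) * y j)) := by ring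

/-- **Each `T(p)` of a setup is diagonalisable**: generalised eigenspaces are eigenspaces
(self-adjointness for the definite weighted form, `w_i ≥ 1`). [cite: Pizer1980, Prop. 2.22] -/
theorem XiSetup.maxGenEigenspace_heckeFamily_eq (S : XiSetup Nplus Nminus) [Fintype (ClassSet S.O)]
    (n : ℕ) (μ : ℂ) :
    (S.heckeFamily n).maxGenEigenspace μ = (S.heckeFamily n).eigenspace μ := by
  refine Literature.NumberTheory.EllipticCurves.ModularForms.maxGenEigenspace_eq_eigenspace_of_selfAdjoint
    S.weightForm (fun u v w => ?_) (fun c v w => ?_) (fun v w => ?_) (fun v hv => ?_)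
    (S.heckeFamily n) (S.weightForm_heckeFamily n) μ
  · simp only [XiSetup.weightForm, Pi.add_apply, mul_add, Finset.sum_add_distrib]
  · simp only [XiSetup.weightForm, Pi.smul_apply, smul_eq_mul, Finset.mul_sum]
    refine Finset.sum_congr rfl fun i _ => by ring
  · simp only [XiSetup.weightForm, map_sum, map_mul, Complex.conj_natCast, Complex.conj_conj]
    refine Finset.sum_congr rfl fun i _ => by ring
  · -- definiteness: `Σ w_i |v_i|² = 0` with `w_i ≥ 1` forces `v = 0`
    funext i
    have hterm : ∀ j, 0 ≤ ((weight S.O j : ℂ) * (conj (v j) * v j)).re ∧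
        ((weight S.O j : ℂ) * (conj (v j) * v j)).im = 0 := by
      intro j
      rw [Complex.conj_mul', ← Complex.ofReal_pow, ← Complex.ofReal_natCast, ← Complex.ofReal_mul,
        Complex.ofReal_re, Complex.ofReal_im]
      exact ⟨mul_nonneg (Nat.cast_nonneg _) (sq_nonneg _), rfl⟩
    have hsum : ∑ j, ((weight S.O j : ℂ) * (conj (v j) * v j)).re = 0 := by
      have := congrArg Complex.re hv
      rwa [XiSetup.weightForm, Complex.re_sum] at this
    have hi := (Finset.sum_eq_zero_iff_of_nonneg fun j _ => (hterm j).1).mp hsum i (Finset.mem_univ i)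
    rw [Complex.conj_mul', ← Complex.ofReal_pow, ← Complex.ofReal_natCast, ← Complex.ofReal_mul,
      Complex.ofReal_re] at hi
    have hw : (0 : ℝ) < (weight S.O i : ℝ) := by exact_mod_cast S.one_le_weight i
    have : ‖v i‖ ^ 2 = 0 := by
      rcases mul_eq_zero.mp hi with h | h
      · exact absurd h hw.ne'
      · exact h
    exact norm_eq_zero.mp (pow_eq_zero_iff two_ne_zero |>.mp this)

/-- **The complexified Brandt matrices of a setup are a semisimple commuting family away from
`N⁺N⁻`** (Pizer 1980 Prop. 2.22: "the `B(n)` with `(n, N) = 1` generate a commutative semisimple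
ring", i.e. are simultaneously diagonalisable). [cite: Pizer1980, Prop. 2.22] -/
theorem XiSetup.isSemisimpleFamily (S : XiSetup Nplus Nminus) [Fintype (ClassSet S.O)] :
    IsSemisimpleFamily (Nplus * Nminus) S.heckeFamily :=
  IsSemisimpleFamily.of_maxGenEigenspace_eq (fun q q' => S.heckeFamily_comm q.2.1 q'.2.1)
    fun q μ => S.maxGenEigenspace_heckeFamily_eq q μ

/-! ### Trace, Eisenstein vector, simultaneous eigenspaces -/

/-- `tr T(n) = Σ_i T(n)_ii` (trace of `mulVec` by a matrix). [folklore] -/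
theorem XiSetup.trace_heckeFamily (S : XiSetup Nplus Nminus) [Fintype (ClassSet S.O)] (n : ℕ) :
    LinearMap.trace ℂ _ (S.heckeFamily n) = ((matrix S.O n).trace : ℂ) := by
  classical
  rw [S.heckeFamily_eq_toLin', Matrix.trace_toLin'_eq, Matrix.trace, Matrix.trace]
  push_cast
  exact Finset.sum_congr rfl fun i _ => S.matrixC_apply n i i

/-- **The Eisenstein vector** `u_i = 1 / w_i` of a setup: a common eigenvector of the `T(p)`,
`p ∤ N⁺N⁻`, with the Eisenstein eigenvalues `p + 1` (column sums `p + 1` and weight symmetry: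
`Σ_j T_ij / w_j = Σ_j T_ji / w_i = (p + 1) / w_i`). [cite: Eichler1973, Ch. II §6 (16)–(17)] -/
theorem XiSetup.heckeFamily_eisensteinVector (S : XiSetup Nplus Nminus) [Fintype (ClassSet S.O)] {p : ℕ}
    (hp : p.Prime) (hpN : ¬ p ∣ Nplus * Nminus) :
    S.heckeFamily p (fun i => ((weight S.O i : ℂ))⁻¹) = ((p : ℂ) + 1) • fun i => ((weight S.O i : ℂ))⁻¹ := by
  funext i
  rw [XiSetup.heckeFamily_apply, Matrix.mulVec, dotProduct, Pi.smul_apply, smul_eq_mul]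
  have hw : ∀ j, (weight S.O j : ℂ) ≠ 0 := fun j => by
    have := S.one_le_weight j
    exact_mod_cast (show (weight S.O j) ≠ 0 by omega)
  have hsymm : ∀ j, ((matrix S.O p i j : ℤ) : ℂ) * ((weight S.O j : ℂ))⁻¹ =
      ((weight S.O i : ℂ))⁻¹ * ((matrix S.O p j i : ℤ) : ℂ) := by
    intro j
    have h := S.weight_mul_matrix_symm p i j
    have h' : ((weight S.O i : ℤ) : ℂ) * ((matrix S.O p i j : ℤ) : ℂ) =
        ((weight S.O j : ℤ) : ℂ) * ((matrix S.O p j i : ℤ) : ℂ) := by exact_mod_cast h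
    push_cast at h'
    rw [eq_inv_mul_iff_mul_eq₀ (hw i), ← mul_assoc, h', mul_comm (weight S.O j : ℂ), mul_assoc,
      mul_inv_cancel₀ (hw j), mul_one]
  simp only [Matrix.map_apply, eq_intCast]
  rw [Finset.sum_congr rfl fun j _ => hsymm j, ← Finset.mul_sum]
  have hcol := S.sum_matrix_prime_eq hp hpN i
  have hcol' : ∑ j, ((matrix S.O p j i : ℤ) : ℂ) = (p : ℂ) + 1 := by exact_mod_cast hcol
  rw [hcol', mul_comm]

/-- **The simultaneous eigenspaces of the Hecke family of a setup are the tree's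
`Brandt.eigenSpace`**: for an integral eigenvalue system `λ`,
`eigenChar (N⁺N⁻) T (p ↦ λ p) = Brandt.eigenSpace ℂ (N⁺N⁻) (Brandt.matrix S.O) λ`. [folklore] -/
theorem XiSetup.eigenChar_heckeFamily_eq_eigenSpace (S : XiSetup Nplus Nminus) [Fintype (ClassSet S.O)]
    (lam : ℕ → ℤ) :
    eigenChar (Nplus * Nminus) S.heckeFamily (fun q => (lam q : ℂ)) =
      eigenSpace ℂ (Nplus * Nminus) (matrix S.O) lam := by
  ext v
  rw [mem_eigenChar_iff, mem_eigenSpace_iff]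
  constructor
  · intro h p hp hpN
    exact h ⟨p, hp, hpN⟩
  · intro h q
    exact h q q.2.1 q.2.2


end Brandt

end Literature.NumberTheory.Automorphic

end
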